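import Summits.QuantumFields.YangMills.Theorems.BalabanUVNodesK1AxV11Defs
import Literature.MathematicalPhysics.QuantumFieldTheory.Balaban1983to89.Node00.N24Thm1Stage13RebindXWithB8PinB10Y0ZW0ChiSepCoPH
import Summits.QuantumFields.YangMills.Theorems.BalabanUVNodesN12PinAtRecordBundleForK1AxRung1VW
import Summits.QuantumFields.YangMills.Theorems.BalabanUVNodesN12AtRecord12Pointed

/-!
# BalabanUVNodes ∕ K1ᴬ LINE 2′ — N24's SHARE OF `stub_nodes13PWSVW` (registered skeleton v11.1 1c0150ff21ca0f8d on stmt-QuantumFields-27239): RUNG 1ⱽᵂ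
# `K1AxV11Defs.NodesAtSomeRecord13PWSVW F` BY NAME from the children's products AT THE RUNG's BOUND θ — the thirteen DAG nodes, window-guarded, at a world S-BOUND
# (`K1AxV11Defs.RecordSV`) to SOME a.e.-revision of the RE-CENTRED Stage-13 record — and the stub's TEXT from the per-node BILLS stated ∀F ∀θ (dag-lead g41 GATE v1.273 (c))

TRACK A (YM-PLAN §2d), node N24 (binder B2, COMPOSITE), seat `pub-ymgap-dag-n24-c` g24 (the -a hand on LINE 2′ per `K1AX-V11-LINE-TABLE.md` v3∕v4; dag-lead g41 hands lever `stub_nodes13PWSVW`), `--kind proof --supports stmt-QuantumFields-27239 --as helper` (count-neutral; conditional producer of the stub's text — the stub stays OPEN until every bill is paid).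

WHAT IS HERE (theorems only; 0 `def`, 0 `sorry`, standard axioms):
* §1 ★ `b16_main_at_recordVAx_of_rOperation_of_cor3With` — N13's node `Dag.B16_main (leavesP w P)` at ANY world bound to the REVISED re-centred datum `datumOfRecord₁₃SepCoPHVAx θ h v` whose `up P`
  carries the 𝐑-operation leaf, from [III] Cor. 3 «with e±» AT THAT REVISED DATUM (`B16.Cor3With (datumOfRecord₁₃SepCoPHVAx …).C γ₁₃ w.em w.ep`, `w.γ ≤ γ₁₃`) — the Ax twin of dag-n13-w3's
  `N13NodeAtRevisedRecordWorldAtRecord13SepCoPHV.b16_main_at_recordV₁₃_of_cor3With`, binding-agnostic (n13-a's `uvSlot_at_construction` at the χ-generic core).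
* §2 ★★ `N24_nodesW_at_recordSV_Ax_pointed` — THE THIRTEEN NODES, WINDOW-GUARDED, at a world `w` with `w.C = (datumOfRecord₁₃SepCoPHVAx F N θ h v).C` whose upstream block is the
  **S-BINDING** `upOfRecord₅CS` over the χ-generic four-pin chain `((((θ.rebindX X′).toStage5₁₃CoPHChi χ⋆).pinB10).pinY Y₀).pinZ (Z11OfRecord ζ)).pinW W₀`, `χ⋆ := chiβOfRecord₁₃Ax F N θ.toStage13Params`:
  N01–N11 + the 𝐑-leaf at the RECORD-REBOUND twin world by this seat's χ glue `Node00.N24_nodes11_rOperation₁₃SepCoPHChi_rebindX_withB8_pinB10Y₀ZW₀_pointed_chi` (✓p810328; the S-binding IS the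
  C-binding `withB8` its own surviving `b8` leaf, `upOfRecord₅CS_eq_withB8` `rfl` ⇒ **N05 ← the SURVIVING [B8] leaf `h05S`**), transported by `leavesP_revision₁₃Ax_eq_update` (✓p801613); N12 from the
  W-pin's `rBasicStep` face ON THE WINDOW RUNS at the bundle of record (`h12`, `hW`, dag-n12-d's currency `Step.InInterval w.γ P.K (gOfRecord₁₃Ax …)`); N13 by §1.
* §3 ★★★ `N24_recordSV_Ax_of_upS_rebindX_pinB10Y₀ZW₀` (the world IS in `K1AxV11Defs.RecordSV F θ h v w`), the three `Iff.rfl` sockets at `XPinned₁₃H θ λ₈ λ₁₂ λ₁₃`, `N24_rung1VW_bodyAt_pointed` ∕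
  `N24_nodesAtSomeRecord13PWSVW_of_pointed` — RUNG 1ⱽᵂ (body ∕ BY NAME) at the witness `(θ, h, v, w)`, `λ := λW` (pin conjunct by dag-n12-d `n12Pin_rung1VW_of_rBasicStep_iff`).
* §4 ★★★★ `N24_rung1VW_bodyAt_of_bills_at` (bills AT θ ⟹ a revision + a world with prescribed `βup` carrying the rung's body — the pointed form stub 2ⱽᵂ re-reads) and `stub1TextVW_of_bills_atWitnessFamily`
  — the registered stub's SIGNATURE `∀ F, Inhabited13 F → NodesAtSomeRecord13PWSVW F` from the per-node BILLS read AT A WITNESS FAMILY `Θ F i` (the θ the rung binds; engine §3 shape):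
  N05 `h05`, N06 `h06`, N07 `h07`, N08 `h08`, N09 `h09` + `h09T`, N10 `h10`, N11 `h11`, 𝐑 `hR`, N12 `h12`, N13 `h13`.  WHICH CHILD BLOCKS the stub = §4's hypothesis list, BY NAME.

HONEST SCOPE ∕ A6.  Implications only; every node's printed content is a DISPLAYED hypothesis, inhabited at NO θ here; nothing of Bałaban asserted; `stub_nodes13PWSVW` NOT closed; K1ᴬ OPEN
(v11.1 0∕6, never summed across lines); N24 COMPOSITE — no discharge, no count claim (discharged 8∕27 · K 1∕4 unmoved).  One finite 𝕋⁴ programme at fixed ε, Bałaban AS PRINTED; R4 would close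
ONLY the conditional finite-𝕋⁴ rung `BalabanLadder.UV` — the YM mass gap (Clay) is NOT proved by any of this; nothing continuum ∕ ℝ⁴ ∕ OS.  No `def`, no `instance`, no `sorry`.
References (bookkeeping only): [Balaban1989LargeFieldII] Thm 1 p.355, (0.1) pp.355–356; [Balaban1988Convergent] (2.18) p.257, Cor. 3 (2.50) p.264; [Balaban1989LargeFieldI] (0.2)–(0.6) p.176, Prop. 1 p.194;
[Balaban1987RG1] (0.17)–(0.20) pp.255–256, Thm 1 p.259, (2.9) p.266; [Balaban1985RegularSpaces] Thm 8 p.101; [Balaban1985UV3] Thm 1 p.257; [Balaban1985BackgroundPropagators] Thm 3.1 p.397; [Balaban1985Variational] Thm 1 p.279.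
-/

noncomputable section

open scoped Matrix.Norms.L2Operator BigOperators
open MeasureTheory
namespace Summit.QuantumFields.YangMills.BalabanUVNodes.N24Stub1VWShareK1AxV11

open Literature.MathematicalPhysics.QuantumFieldTheory.Balaban1983to89
open Literature.MathematicalPhysics.QuantumFieldTheory.Balaban1983to89.Node00
open DagBinding T4Continuum T4DatumAssembly FlowStepRuns AveragingRT
open B16NodeKnitRepTowerOfRecord (uvSlot_at_construction)
open B16NodeKnitRecord5 (b16_main_of_rOperation_of_uvSlot)
open Summit.QuantumFields.YangMills.BalabanUVNodes.N13NodeAtRevisedRecordWorldAtRecord13SepCoPHVAx (leavesP_revision₁₃Ax_eq_update)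
open Summit.QuantumFields.YangMills.BalabanUVNodes.N12PinAtRecordBundleForK1AxRung1VW (smallCouplings_leavesP_iff_stepInInterval_gOfRecord₁₃Ax)
open Summit.QuantumFields.YangMills.BalabanUVNodes.N12AtRecord12Pointed (exists_printedCarriers15_b15Leaf)
open Summit.QuantumFields.YangMills.Theorems.K1AxV11Defs (Inhabited13 RecordSV NodesAtSomeRecord13PWSVW)

variable {F : T4Family} {N : ℕ} [NeZero N]
/-! ## §1. ★ N13's node at a world bound to the REVISED RE-CENTRED datum, binding-agnostic, from Cor. 3 «with e±» at that datum -/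

/-- **★ N13 AT A REVISED RE-CENTRED-RECORD WORLD FROM [III] COR. 3 «WITH e±» AT THE REVISED DATUM** (Ax twin of dag-n13-w3's `b16_main_at_recordV₁₃_of_cor3With`, binding-agnostic): for
`w.C = (datumOfRecord₁₃SepCoPHVAx F N θ h v).C`, the 𝐑-operation leaf of `w.up P` (whatever the binding), `w.γ ≤ γ₁₃` and `B16.Cor3With (datumOfRecord₁₃SepCoPHVAx F N θ h v).C γ₁₃ w.em w.ep`
⟹ `Dag.B16_main (leavesP w P)` — n13-a's `uvSlot_at_construction` at the χ-generic core `coreOfRecord₁₃CoPHChi θ χ⋆`, `ρ := v.ρ`, trivial representation, laws `SLaw₁₃CoPHChi θ χ⋆ P k`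
(`sect2Form_coreOfRecord₁₃CoPH_iff_chi`), the revised datum's construction `datumOfRecord₁₃SepCoPHV_C_chi` (`rfl`).  HYPOTHESES displayed; N13 NOT discharged.
[cite: Balaban1989LargeFieldII, Thm 1 p.355, (0.1) pp.355–356, p.387, p.391; Balaban1988Convergent, (2.18) p.257, Cor. 3 (2.50) p.264; Balaban1987RG1, (2.9) p.266 (bookkeeping)] -/
theorem b16_main_at_recordVAx_of_rOperation_of_cor3With (θ : Stage13HParams F N) (h : θ.Provisos₁₃SepCoPHAx F N) (v : Revision₁₃Ax F N θ h) (w : WorldP) (P : B12.RunParams)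
    (hC : w.C = (datumOfRecord₁₃SepCoPHVAx F N θ h v).C) (hR : (w.up P).rOperation) {γ₁₃ : ℝ} (hγ : w.γ ≤ γ₁₃)
    (hcor : B16.Cor3With (datumOfRecord₁₃SepCoPHVAx F N θ h v).C γ₁₃ w.em w.ep) :
    Dag.B16_main (leavesP w P) :=
  b16_main_of_rOperation_of_uvSlot w P hR
    (uvSlot_at_construction F N (coreOfRecord₁₃CoPHChi F N θ (chiβOfRecord₁₃Ax F N θ.toStage13Params)) v.ρ w P (Rep := fun _ => Unit) (fun _ => ())
      (fun k _ => SLaw₁₃CoPHChi F N θ (chiβOfRecord₁₃Ax F N θ.toStage13Params) P k) (fun k _ => v.ρ P k)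
      (hC.trans (datumOfRecord₁₃SepCoPHV_C_chi F N θ (chiβOfRecord₁₃Ax F N θ.toStage13Params) h v)) (fun _ => rfl)
      (fun k _ hs => (sect2Form_coreOfRecord₁₃CoPH_iff_chi F N θ (chiβOfRecord₁₃Ax F N θ.toStage13Params) P k).1 hs) hγ
      fun hP k hk _ U => hcor P hP k hk U)

/-! ## §2. ★★ The thirteen nodes, window-guarded, at a world S-bound to the χ⋆-four-pin chain and bound to the REVISED re-centred datum -/

/-- **THE TWELVE VERSION-BLIND NODES PLUS N13** (kernel census of `Dag.B4_main … B16_main` by structure η, as dag-n13-w3's `nodes_update_uvBounds`): eleven nodes and `B15_main` at a leaf tuple,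
`B16_main` at the tuple with its `uvBounds` slot replaced ⟹ the thirteen at the replaced tuple. [cite: Balaban1989LargeFieldII, Thm 1 p.355 (bookkeeping)] -/
theorem nodes_update_uvBounds_of_nodes11_b15_b16 (ℓ : Dag.Leaves) (X : Prop)
    (hn : Dag.B4_main ℓ ∧ Dag.B5_main ℓ ∧ Dag.B6_main ℓ ∧ Dag.B7_main ℓ ∧ Dag.B8_main ℓ ∧ Dag.B9_main ℓ ∧ Dag.B10_main ℓ ∧ Dag.B11_main ℓ ∧
      Dag.B12_main ℓ ∧ Dag.B13_main ℓ ∧ Dag.B14_main ℓ) (h15 : Dag.B15_main ℓ) (h16 : Dag.B16_main { ℓ with uvBounds := X }) :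
    Nodes { ℓ with uvBounds := X } := by
  obtain ⟨h4, h5, h6, h7, h8, h9, h10, h11, h12, h13, h14⟩ := hn
  exact ⟨h4, h5, h6, h7, h8, h9, h10, h11, h12, h13, h14, h15, h16⟩

/-- **★★ N24 · THE THIRTEEN DAG NODES, WINDOW-GUARDED, AT A WORLD S-BOUND TO THE χ⋆-FOUR-PIN CHAIN OF `θ.rebindX X′` AND BOUND TO THE REVISED RE-CENTRED DATUM** (`χ⋆ := chiβOfRecord₁₃Ax θ`; `X′`,
`Y₀`, `ζ`, `W₀`, `λW` FREE): **N05 ← the SURVIVING `b8` leaf of the S-binding** `h05S` (displayed at the chain; at dag-n05-d's H-pin it is `B8LeafOfRecordSubBH θ₃ λ₈`); N06 `h06 : B9LeafX Y₀`;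
N07 `B11Leaf (Z11OfRecord ζ)`; N08 `PrintedUV3V N θ.L`; N09 Lemma 4 at `X′ P` + Theorem-3 member `h09T` (world-keyed, at the record-rebound twin); N10 the [B13] socket at `X′ P`; N11 (S1ᵀ) `h11`
(world-keyed, at the twin); the 𝐑-reading `hR`; **N12 ON THE WINDOW RUNS at the bundle of record** `h12` where the W-pin carries it (`hW`; off the pinned runs `W₀` carries any true leaf, `hW0`);
**N13 ← Cor. 3 «with e±» at the revised datum** `hcor` (`w.γ ≤ γ₁₃`).  N01–N11 + 𝐑 at the twin by this seat's χ glue (✓p810328), transported by `leavesP_revision₁₃Ax_eq_update`; N12 by the W-pin's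
`rBasicStep` face; N13 by §1.  CONDITIONAL on every displayed hypothesis; nothing of Bałaban asserted.
[cite: Balaban1989LargeFieldII, Thm 1 p.355, (0.1) pp.355–356, p.387, p.391; Balaban1985RegularSpaces, Thm 8 (1.146) p.101 (surviving form); Balaban1985BackgroundPropagators, Thm 3.1 p.397; Balaban1985Variational, Thm 1 p.279; Balaban1985UV3, Thm 1 p.257, Thm 2 p.272; Balaban1987RG1, Lemma 4 p.280, Thm 1 p.259, (2.9) p.266; Balaban1988RG2Cluster, Lemmas 1–3 pp.9–20; Balaban1988Convergent, Thm 2 p.263, Cor. 3 (2.50) p.264; Balaban1989LargeFieldI, (0.2)–(0.6) p.176, Prop. 1 p.194 (bookkeeping over the cell's DAG)] -/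
theorem N24_nodesW_at_recordSV_Ax_pointed (θ : Stage13HParams F N) (h : θ.Provisos₁₃SepCoPHAx F N) (hθ : θ.Admissible F N) (v : Revision₁₃Ax F N θ h)
    (X' : B12.RunParams → PrintedCarriersR) (Y₀ : PrintedCarriers9X) (ζ : ResidZ F N) (W₀ : B12.RunParams → PrintedCarriers15) (lamW : ResidW F N) (w : WorldP)
    (hC : w.C = (datumOfRecord₁₃SepCoPHVAx F N θ h v).C) (hγ : 0 < w.γ ∧ w.γ ≤ θ.γ) (hL : w.L = (θ.L : ℝ))
    (hup : ∀ P, w.up P = upOfRecord₅CS F N ((((((θ.rebindX F N X').toStage5₁₃CoPHChi F N (chiβOfRecord₁₃Ax F N θ.toStage13Params)).pinB10 F N).pinY F N Y₀).pinZ F N (Z11OfRecord F N ζ)).pinW F N W₀) P)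
    (h05S : ∀ P : B12.RunParams,
      (upOfRecord₅CS F N ((((((θ.rebindX F N X').toStage5₁₃CoPHChi F N (chiβOfRecord₁₃Ax F N θ.toStage13Params)).pinB10 F N).pinY F N Y₀).pinZ F N (Z11OfRecord F N ζ)).pinW F N W₀) P).b8)
    (h06 : B9LeafX Y₀)
    (h07 : B11Leaf (Z11OfRecord F N ζ))
    (h08 : PrintedUV3V N θ.L)
    (h09 : ∀ P : B12.RunParams, B12Sec2to5.Lemma4Printed (X' P).F12 (X' P).c12)
    (h09T : ∀ P : B12.RunParams, (leavesP { w with C := (datumOfRecord₁₃SepCoPHAx F N θ h).C } P).smallCouplings →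
      (leavesP { w with C := (datumOfRecord₁₃SepCoPHAx F N θ h).C } P).smallFieldInductive)
    (h10 : ∀ P : B12.RunParams, B9LeafX Y₀ →
      (B10.Thm1PrintedCompact (((((((θ.rebindX F N X').toStage5₁₃CoPHChi F N (chiβOfRecord₁₃Ax F N θ.toStage13Params)).pinB10 F N).pinY F N Y₀).pinZ F N (Z11OfRecord F N ζ)).pinW F N W₀).res.X P).runs10 ∧
          B10.Thm2Printed (((((((θ.rebindX F N X').toStage5₁₃CoPHChi F N (chiβOfRecord₁₃Ax F N θ.toStage13Params)).pinB10 F N).pinY F N Y₀).pinZ F N (Z11OfRecord F N ζ)).pinW F N W₀).res.X P).runs10) →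
        B11Leaf (Z11OfRecord F N ζ) → B12Sec2to5.Lemma4Printed (X' P).F12 (X' P).c12 →
          B13.Lemma1Printed (X' P).S13 (X' P).c13 ∧ B13.Lemma2Printed (X' P).S13 (X' P).c13 ∧ B13.Lemma3Printed (X' P).S13 (X' P).c13)
    (h11 : ∀ P : B12.RunParams, (leavesP { w with C := (datumOfRecord₁₃SepCoPHAx F N θ h).C } P).b7 → (leavesP { w with C := (datumOfRecord₁₃SepCoPHAx F N θ h).C } P).b8 →
      (leavesP { w with C := (datumOfRecord₁₃SepCoPHAx F N θ h).C } P).b9 → (leavesP { w with C := (datumOfRecord₁₃SepCoPHAx F N θ h).C } P).b10 →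
      (leavesP { w with C := (datumOfRecord₁₃SepCoPHAx F N θ h).C } P).b11 → (leavesP { w with C := (datumOfRecord₁₃SepCoPHAx F N θ h).C } P).smallCouplings →
      (leavesP { w with C := (datumOfRecord₁₃SepCoPHAx F N θ h).C } P).smallFieldInductive → (leavesP { w with C := (datumOfRecord₁₃SepCoPHAx F N θ h).C } P).flowControl →
        ∀ k, k < P.K → SLaw₁₃CoPHChi F N θ (chiβOfRecord₁₃Ax F N θ.toStage13Params) P k → TLaw₁₃CoPHChi F N θ (chiβOfRecord₁₃Ax F N θ.toStage13Params) P k)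
    (hR : ∀ (P : B12.RunParams) (k : ℕ), k < P.K → TLaw₁₃CoPHChi F N θ (chiβOfRecord₁₃Ax F N θ.toStage13Params) P k → SLaw₁₃CoPHChi F N θ (chiβOfRecord₁₃Ax F N θ.toStage13Params) P (k + 1))
    (hW : ∀ P : B12.RunParams, lamW.kSel P < P.K → W₀ P = WOfRecord₁₃Ax F N θ.toStage13Params lamW P)
    (hW0 : ∀ P : B12.RunParams, ¬ lamW.kSel P < P.K → B15Leaf (W₀ P))
    (h12 : ∀ P : B12.RunParams, lamW.kSel P < P.K → Step.InInterval w.γ P.K (gOfRecord₁₃Ax F N θ.toStage13Params P) → B15Leaf (WOfRecord₁₃Ax F N θ.toStage13Params lamW P))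
    {γ₁₃ : ℝ} (hγ₁₃ : w.γ ≤ γ₁₃) (hcor : B16.Cor3With (datumOfRecord₁₃SepCoPHVAx F N θ h v).C γ₁₃ w.em w.ep) :
    ∀ P : B12.RunParams, (leavesP w P).smallCouplings → Nodes (leavesP w P) := by
  intro P hsc
  -- the record-rebound twin world: same letters, same `up`, construction re-bound to the re-centred record datum
  have hnodes₀ := N24_nodes11_rOperation₁₃SepCoPHChi_rebindX_withB8_pinB10Y₀ZW₀_pointed_chi θ (chiβOfRecord₁₃Ax F N θ.toStage13Params) h hθ X' Y₀ ζ W₀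
    (fun P => (upOfRecord₅CS F N ((((((θ.rebindX F N X').toStage5₁₃CoPHChi F N (chiβOfRecord₁₃Ax F N θ.toStage13Params)).pinB10 F N).pinY F N Y₀).pinZ F N (Z11OfRecord F N ζ)).pinW F N W₀) P).b8)
    { w with C := (datumOfRecord₁₃SepCoPHAx F N θ h).C } rfl hγ hL (fun P => by rw [show ({ w with C := (datumOfRecord₁₃SepCoPHAx F N θ h).C } : WorldP).up P = w.up P from rfl, hup P]; rfl)
    h05S h06 h07 h08 h09 h09T h10 h11 hR P
  -- N12 at the W-pinned world: the `rBasicStep` leaf IS `B15Leaf (W₀ P)`, supplied on the pinned window runs by N12's leaf, elsewhere by `hW0`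
  have hrb : (w.up P).rBasicStep ↔ B15Leaf (W₀ P) := by
    rw [hup P]
    exact upOfRecord₅C_pinW_rBasicStep_iff F N _ W₀ P
  have h15leaf : (w.up P).rBasicStep := by
    rw [hrb]
    by_cases hk : lamW.kSel P < P.K
    · rw [hW P hk]
      exact h12 P hk ((smallCouplings_leavesP_iff_stepInInterval_gOfRecord₁₃Ax θ h v w hC P).1 hsc)
    · exact hW0 P hk
  have h15 : Dag.B15_main (leavesP { w with C := (datumOfRecord₁₃SepCoPHAx F N θ h).C } P) := B15LeafKnit.b15_main_of_up (U := w.up P) rfl h15leaf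
  -- N13 at the REVISED world (§1), the 𝐑-leaf from the twin (same `up`)
  have h16 : Dag.B16_main (leavesP w P) := b16_main_at_recordVAx_of_rOperation_of_cor3With θ h v w P hC (hnodes₀).2 hγ₁₃ hcor
  rw [leavesP_revision₁₃Ax_eq_update F N θ h v w P hC] at h16 ⊢
  exact nodes_update_uvBounds_of_nodes11_b15_b16 _ _ (hnodes₀).1 h15 h16

/-! ## §3. ★★★ `N = 2`: the S-class `RecordSV` at the chain, the three H-pin sockets, and RUNG 1ⱽᵂ `K1AxV11Defs.NodesAtSomeRecord13PWSVW F` BY NAME at the witness -/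

section Rung
variable {F : T4Family}
/-- **A WORLD S-BOUND TO THE χ⋆-FOUR-PIN CHAIN OF `θ.rebindX X′` AND BOUND TO THE REVISED RE-CENTRED DATUM IS IN THE SLOT CLASS `K1AxV11Defs.RecordSV F θ h v w`** (∃-body by name):
presenting parameter the quadruply pinned `((((θ.rebindX X′).pinB10).pinY Y₀).pinZ (Z11OfRecord ζ)).pinW W₀` with provisos `Provisos₁₃SepCoPHChi.rebindX ∕ .pin*` at the FIXED re-centred slot `χ⋆`
(the pins and the re-binding keep `ν`, `ε₂₉`, hence `χ⋆` — `rfl`), admissibility `Iff.rfl` ×5, the same re-centred datum by this seat's χ-carrier rows `datumOfRecord₁₃SepCoPH_rebindX_chi ∕ _pin*_chi`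
(✓p809856), the binding by `toStage5₁₃CoPH_pin*_chi` (✓p809721).  The Ax ∕ VW twin of this seat's g6 `N24_recordS₁₃SepCoPH_of_upS_rebindX_view`.
[cite: Balaban1989LargeFieldII, Thm 1 + (0.1) pp.355–356; Balaban1988Convergent, (2.18) p.257; Balaban1985RegularSpaces, Thm 8 (1.146) p.101; Balaban1985UV3, Thm 1 p.257; Balaban1985BackgroundPropagators, Thm 3.1 p.397; Balaban1985Variational, Thm 1 p.279; Balaban1989LargeFieldI, (0.2) p.176; Balaban1987RG1, (2.9) p.266 (bookkeeping)] -/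
theorem N24_recordSV_Ax_of_upS_rebindX_pinB10Y₀ZW₀ (θ : Stage13HParams F 2) (h : θ.Provisos₁₃SepCoPHAx F 2) (hθ : θ.Admissible F 2) (v : Revision₁₃Ax F 2 θ h)
    (X' : B12.RunParams → PrintedCarriersR) (Y₀ : PrintedCarriers9X) (ζ : ResidZ F 2) (W₀ : B12.RunParams → PrintedCarriers15) (w : WorldP)
    (hC : w.C = (datumOfRecord₁₃SepCoPHVAx F 2 θ h v).C) (hγ : 0 < w.γ ∧ w.γ ≤ θ.γ) (hL : w.L = (θ.L : ℝ))
    (hup : ∀ P, w.up P = upOfRecord₅CS F 2 ((((((θ.rebindX F 2 X').toStage5₁₃CoPHChi F 2 (chiβOfRecord₁₃Ax F 2 θ.toStage13Params)).pinB10 F 2).pinY F 2 Y₀).pinZ F 2 (Z11OfRecord F 2 ζ)).pinW F 2 W₀) P) :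
    RecordSV F θ h v w := by
  have hX : (θ.rebindX F 2 X').Provisos₁₃SepCoPHChi F 2 (chiβOfRecord₁₃Ax F 2 θ.toStage13Params) := h.rebindX X'
  have hDX : datumOfRecord₁₃SepCoPHChi F 2 (θ.rebindX F 2 X') (chiβOfRecord₁₃Ax F 2 θ.toStage13Params) hX =
      datumOfRecord₁₃SepCoPHChi F 2 θ (chiβOfRecord₁₃Ax F 2 θ.toStage13Params) h :=
    datumOfRecord₁₃SepCoPH_rebindX_chi F 2 θ (chiβOfRecord₁₃Ax F 2 θ.toStage13Params) h X' hX
  refine ⟨((((θ.rebindX F 2 X').pinB10 F 2).pinY F 2 Y₀).pinZ F 2 (Z11OfRecord F 2 ζ)).pinW F 2 W₀,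
    ((hX.pinB10.pinY Y₀).pinZ (Z11OfRecord F 2 ζ)).pinW W₀,
    (Stage13Params.pinW_admissible_iff F 2 _ _).2 ((Stage13Params.pinZ_admissible_iff F 2 _ _).2
      ((Stage13Params.pinY_admissible_iff F 2 _ _).2 ((Stage13Params.pinB10_admissible_iff F 2 _).2
        ((Stage13HParams.rebindX_admissible_iff F 2 θ X').2 hθ)))), ?_, hC, hγ, hL, fun P => ?_⟩
  · exact hDX.symm.trans ((datumOfRecord₁₃SepCoPH_pinB10_chi F 2 _ (chiβOfRecord₁₃Ax F 2 θ.toStage13Params) hX).symm.trans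
      ((datumOfRecord₁₃SepCoPH_pinY_chi F 2 _ (chiβOfRecord₁₃Ax F 2 θ.toStage13Params) hX.pinB10 Y₀).symm.trans
        ((datumOfRecord₁₃SepCoPH_pinZ_chi F 2 _ (chiβOfRecord₁₃Ax F 2 θ.toStage13Params) (hX.pinB10.pinY Y₀) (Z11OfRecord F 2 ζ)).symm.trans
          (datumOfRecord₁₃SepCoPH_pinW_chi F 2 _ (chiβOfRecord₁₃Ax F 2 θ.toStage13Params) ((hX.pinB10.pinY Y₀).pinZ (Z11OfRecord F 2 ζ)) W₀).symm)))
  · rw [hup P, Stage13HParams.toStage5₁₃CoPH_pinW_chi, Stage13HParams.toStage5₁₃CoPH_pinZ_chi, Stage13HParams.toStage5₁₃CoPH_pinY_chi, Stage13HParams.toStage5₁₃CoPH_pinB10_chi]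
    rfl  -- the pins and the re-binding keep `ν`, `ε₂₉`: `chiβOfRecord₁₃Ax` of the presenting parameter IS `χ⋆`

variable (θ : Stage13HParams F 2) (lam8 : ResidB8 θ.toStage3Params) (lam12 : ResidB12 F 2 θ.τ9.M) (lam13 : B12.RunParams → ResidB13 θ.toStage3Params)
  (Y₀ : PrintedCarriers9X) (ζ : ResidZ F 2) (W₀ : B12.RunParams → PrintedCarriers15) (P : B12.RunParams) in
/-- **N05's SOCKET AT dag-n05-d's H-PIN, χ⋆-chain edition** (`Iff.rfl`; cf. dag-n05-d `socket05S_view₁₃CoPHB10YZW_pinX3H_iff`): the surviving `b8` leaf of the S-binding over the χ⋆-four-pin chain of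
`θ.rebindX (XPinned₁₃H θ λ₈ λ₁₂ λ₁₃)` IS the REPAIRED SURVIVING SLOT `B8LeafOfRecordSubBH θ₃ λ₈` — the [B10] ∕ Y ∕ Z ∕ W pins, the view and the slot `χ⋆` do not touch the [B8] group.
[cite: Balaban1985RegularSpaces, Thm 2 p.83, Thm 8 (1.146) p.101 (the surviving leaf at the repaired objects of record)] -/
theorem socket05S_chain_pinX3H_iff_Ax :
    (upOfRecord₅CS F 2 ((((((θ.rebindX F 2 (XPinned₁₃H F 2 θ.toStage13Params lam8 lam12 lam13)).toStage5₁₃CoPHChi F 2 (chiβOfRecord₁₃Ax F 2 θ.toStage13Params)).pinB10 F 2).pinY F 2 Y₀).pinZ F 2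
      (Z11OfRecord F 2 ζ)).pinW F 2 W₀) P).b8 ↔ B8LeafOfRecordSubBH θ.toStage3Params lam8 :=
  Iff.rfl

variable (θ : Stage13HParams F 2) (lam8 : ResidB8 θ.toStage3Params) (lam12 : ResidB12 F 2 θ.τ9.M) (lam13 : B12.RunParams → ResidB13 θ.toStage3Params) (P : B12.RunParams) in
/-- **N09's SOCKET at the X-pinned family** (`Iff.rfl`; dag-n05-d `socket09_pinX3H_iff`): Lemma 4 at the pinned bundle's [B12] group IS Lemma 4 at the frame of record `F12OfRecord₁₂ θ₁₂ λ₁₂ P`.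
[cite: Balaban1987RG1, Lemma 4 p.280 (objects of record)] -/
theorem socket09_XPinned₁₃H_iff :
    B12Sec2to5.Lemma4Printed (XPinned₁₃H F 2 θ.toStage13Params lam8 lam12 lam13 P).F12 (XPinned₁₃H F 2 θ.toStage13Params lam8 lam12 lam13 P).c12 ↔
      B12Sec2to5.Lemma4Printed (F12OfRecord₁₂ F 2 θ.toStage12Params lam12 P) (lam12 P).consts :=
  Iff.rfl

variable (θ : Stage13HParams F 2) (lam8 : ResidB8 θ.toStage3Params) (lam12 : ResidB12 F 2 θ.τ9.M) (lam13 : B12.RunParams → ResidB13 θ.toStage3Params) (P : B12.RunParams) in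
/-- **N10's SOCKET at the X-pinned family** (`Iff.rfl`; dag-n05-d `socket10_pinX3H_iff`): Lemmas 1–3 at the pinned bundle's [B13] group ARE the [B13] leaf of record `B13LeafOfRecord θ₃ (λ₁₃ P)`.
[cite: Balaban1988RG2Cluster, Lemma 1 p.9, Lemma 2 p.11, Lemma 3 p.20 (objects of record)] -/
theorem socket10_XPinned₁₃H_iff :
    (B13.Lemma1Printed (XPinned₁₃H F 2 θ.toStage13Params lam8 lam12 lam13 P).S13 (XPinned₁₃H F 2 θ.toStage13Params lam8 lam12 lam13 P).c13 ∧
        B13.Lemma2Printed (XPinned₁₃H F 2 θ.toStage13Params lam8 lam12 lam13 P).S13 (XPinned₁₃H F 2 θ.toStage13Params lam8 lam12 lam13 P).c13 ∧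
          B13.Lemma3Printed (XPinned₁₃H F 2 θ.toStage13Params lam8 lam12 lam13 P).S13 (XPinned₁₃H F 2 θ.toStage13Params lam8 lam12 lam13 P).c13) ↔
      B13LeafOfRecord θ.toStage3Params (lam13 P) :=
  Iff.rfl

/-- **★★★ RUNG 1ⱽᵂ's BODY AT THE WITNESS `(θ, h, v, w)`, `λ := λW`** (the matrix of `K1AxV11Defs.NodesAtSomeRecord13PWSVW F` after its four witness binders, verbatim): unity ∧ slots,
admissibility, the slot class (above), the window-guarded thirteen nodes (§2), N08's printed sentence `h08`, and the [IV] pin at the W-pinned world (dag-n12-d `n12Pin_rung1VW_of_rBasicStep_iff`: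
the world's `rBasicStep` leaf IS `B15Leaf (W₀ P)`, `upOfRecord₅C_pinW_rBasicStep_iff`, and `W₀` IS the bundle of record on the pinned runs).  POINTED, so that the LINE's later rungs can KEEP this
witness (stub 2ⱽᵂ attaches run rows with `B + r ≤ w.βup` to the SAME `w`).  COMPOSITE: the rung's body GIVEN the children; nothing is discharged.
[cite: Balaban1989LargeFieldII, Thm 1 p.355, (0.1) pp.355–356, p.391; Balaban1988Convergent, Cor. 3 (2.50) p.264; Balaban1985UV3, Thm 1 p.257 + Thm 2 p.272; Balaban1989LargeFieldI, (0.2)–(0.6) p.176, Prop. 1 p.194; Balaban1987RG1, Thm 1 p.259, (2.9) p.266 (bookkeeping)] -/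
theorem N24_rung1VW_bodyAt_pointed (θ : Stage13HParams F 2) (h : θ.Provisos₁₃SepCoPHAx F 2) (hθ : θ.Admissible F 2)
    (hU : θ.ZhUnity F 2 ∧ θ.SlotsNondegenerate₁₃Ax F 2) (v : Revision₁₃Ax F 2 θ h)
    (X' : B12.RunParams → PrintedCarriersR) (Y₀ : PrintedCarriers9X) (ζ : ResidZ F 2) (W₀ : B12.RunParams → PrintedCarriers15) (lamW : ResidW F 2) (w : WorldP)
    (hC : w.C = (datumOfRecord₁₃SepCoPHVAx F 2 θ h v).C) (hγ : 0 < w.γ ∧ w.γ ≤ θ.γ) (hL : w.L = (θ.L : ℝ))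
    (hup : ∀ P, w.up P = upOfRecord₅CS F 2 ((((((θ.rebindX F 2 X').toStage5₁₃CoPHChi F 2 (chiβOfRecord₁₃Ax F 2 θ.toStage13Params)).pinB10 F 2).pinY F 2 Y₀).pinZ F 2 (Z11OfRecord F 2 ζ)).pinW F 2 W₀) P)
    (h05S : ∀ P : B12.RunParams,
      (upOfRecord₅CS F 2 ((((((θ.rebindX F 2 X').toStage5₁₃CoPHChi F 2 (chiβOfRecord₁₃Ax F 2 θ.toStage13Params)).pinB10 F 2).pinY F 2 Y₀).pinZ F 2 (Z11OfRecord F 2 ζ)).pinW F 2 W₀) P).b8)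
    (h06 : B9LeafX Y₀)
    (h07 : B11Leaf (Z11OfRecord F 2 ζ))
    (h08 : PrintedUV3V 2 θ.L)
    (h09 : ∀ P : B12.RunParams, B12Sec2to5.Lemma4Printed (X' P).F12 (X' P).c12)
    (h09T : ∀ P : B12.RunParams, (leavesP { w with C := (datumOfRecord₁₃SepCoPHAx F 2 θ h).C } P).smallCouplings →
      (leavesP { w with C := (datumOfRecord₁₃SepCoPHAx F 2 θ h).C } P).smallFieldInductive)
    (h10 : ∀ P : B12.RunParams, B9LeafX Y₀ →
      (B10.Thm1PrintedCompact (((((((θ.rebindX F 2 X').toStage5₁₃CoPHChi F 2 (chiβOfRecord₁₃Ax F 2 θ.toStage13Params)).pinB10 F 2).pinY F 2 Y₀).pinZ F 2 (Z11OfRecord F 2 ζ)).pinW F 2 W₀).res.X P).runs10 ∧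
          B10.Thm2Printed (((((((θ.rebindX F 2 X').toStage5₁₃CoPHChi F 2 (chiβOfRecord₁₃Ax F 2 θ.toStage13Params)).pinB10 F 2).pinY F 2 Y₀).pinZ F 2 (Z11OfRecord F 2 ζ)).pinW F 2 W₀).res.X P).runs10) →
        B11Leaf (Z11OfRecord F 2 ζ) → B12Sec2to5.Lemma4Printed (X' P).F12 (X' P).c12 →
          B13.Lemma1Printed (X' P).S13 (X' P).c13 ∧ B13.Lemma2Printed (X' P).S13 (X' P).c13 ∧ B13.Lemma3Printed (X' P).S13 (X' P).c13)
    (h11 : ∀ P : B12.RunParams, (leavesP { w with C := (datumOfRecord₁₃SepCoPHAx F 2 θ h).C } P).b7 → (leavesP { w with C := (datumOfRecord₁₃SepCoPHAx F 2 θ h).C } P).b8 →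
      (leavesP { w with C := (datumOfRecord₁₃SepCoPHAx F 2 θ h).C } P).b9 → (leavesP { w with C := (datumOfRecord₁₃SepCoPHAx F 2 θ h).C } P).b10 →
      (leavesP { w with C := (datumOfRecord₁₃SepCoPHAx F 2 θ h).C } P).b11 → (leavesP { w with C := (datumOfRecord₁₃SepCoPHAx F 2 θ h).C } P).smallCouplings →
      (leavesP { w with C := (datumOfRecord₁₃SepCoPHAx F 2 θ h).C } P).smallFieldInductive → (leavesP { w with C := (datumOfRecord₁₃SepCoPHAx F 2 θ h).C } P).flowControl →
        ∀ k, k < P.K → SLaw₁₃CoPHChi F 2 θ (chiβOfRecord₁₃Ax F 2 θ.toStage13Params) P k → TLaw₁₃CoPHChi F 2 θ (chiβOfRecord₁₃Ax F 2 θ.toStage13Params) P k)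
    (hR : ∀ (P : B12.RunParams) (k : ℕ), k < P.K → TLaw₁₃CoPHChi F 2 θ (chiβOfRecord₁₃Ax F 2 θ.toStage13Params) P k → SLaw₁₃CoPHChi F 2 θ (chiβOfRecord₁₃Ax F 2 θ.toStage13Params) P (k + 1))
    (hK : ∀ P : B12.RunParams, 1 ≤ P.K → lamW.kSel P < P.K)
    (hW : ∀ P : B12.RunParams, lamW.kSel P < P.K → W₀ P = WOfRecord₁₃Ax F 2 θ.toStage13Params lamW P)
    (hW0 : ∀ P : B12.RunParams, ¬ lamW.kSel P < P.K → B15Leaf (W₀ P))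
    (h12 : ∀ P : B12.RunParams, lamW.kSel P < P.K → Step.InInterval w.γ P.K (gOfRecord₁₃Ax F 2 θ.toStage13Params P) → B15Leaf (WOfRecord₁₃Ax F 2 θ.toStage13Params lamW P))
    {γ₁₃ : ℝ} (hγ₁₃ : w.γ ≤ γ₁₃) (hcor : B16.Cor3With (datumOfRecord₁₃SepCoPHVAx F 2 θ h v).C γ₁₃ w.em w.ep) :
    (θ.ZhUnity F 2 ∧ θ.SlotsNondegenerate₁₃Ax F 2) ∧ θ.Admissible F 2 ∧ RecordSV F θ h v w ∧
      (∀ P : B12.RunParams, (leavesP w P).smallCouplings → Nodes (leavesP w P)) ∧ PrintedUV3V 2 θ.L ∧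
      ∃ lam : ResidW F 2, (∀ P : B12.RunParams, 1 ≤ P.K → lam.kSel P < P.K) ∧
        ∀ P : B12.RunParams, lam.kSel P < P.K → (leavesP w P).smallCouplings → ((leavesP w P).rBasicStep ↔ B15Leaf (WOfRecord₁₃Ax F 2 θ.toStage13Params lam P)) := by
  have hrb : ∀ P : B12.RunParams, (leavesP w P).rBasicStep ↔ B15Leaf (W₀ P) := fun P => by
    show (w.up P).rBasicStep ↔ _
    rw [hup P]
    exact upOfRecord₅C_pinW_rBasicStep_iff F 2 _ W₀ P
  exact ⟨hU, hθ, N24_recordSV_Ax_of_upS_rebindX_pinB10Y₀ZW₀ θ h hθ v X' Y₀ ζ W₀ w hC hγ hL hup,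
    N24_nodesW_at_recordSV_Ax_pointed θ h hθ v X' Y₀ ζ W₀ lamW w hC hγ hL hup h05S h06 h07 h08 h09 h09T h10 h11 hR hW hW0 h12 hγ₁₃ hcor, h08,
    Summit.QuantumFields.YangMills.BalabanUVNodes.N12PinAtRecordBundleForK1AxRung1VW.n12Pin_rung1VW_of_rBasicStep_iff θ w W₀ lamW hK hrb hW⟩

/-- **★★★ RUNG 1ⱽᵂ `K1AxV11Defs.NodesAtSomeRecord13PWSVW F` BY NAME AT THE WITNESS `(θ, h, v, w)`** — the previous theorem under its four ∃-binders.  COMPOSITE; nothing is discharged.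
[cite: Balaban1989LargeFieldII, Thm 1 p.355, (0.1) pp.355–356, p.391; Balaban1989LargeFieldI, (0.2)–(0.6) p.176, Prop. 1 p.194 (bookkeeping)] -/
theorem N24_nodesAtSomeRecord13PWSVW_of_pointed (θ : Stage13HParams F 2) (h : θ.Provisos₁₃SepCoPHAx F 2) (hθ : θ.Admissible F 2)
    (hU : θ.ZhUnity F 2 ∧ θ.SlotsNondegenerate₁₃Ax F 2) (v : Revision₁₃Ax F 2 θ h)
    (X' : B12.RunParams → PrintedCarriersR) (Y₀ : PrintedCarriers9X) (ζ : ResidZ F 2) (W₀ : B12.RunParams → PrintedCarriers15) (lamW : ResidW F 2) (w : WorldP)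
    (hC : w.C = (datumOfRecord₁₃SepCoPHVAx F 2 θ h v).C) (hγ : 0 < w.γ ∧ w.γ ≤ θ.γ) (hL : w.L = (θ.L : ℝ))
    (hup : ∀ P, w.up P = upOfRecord₅CS F 2 ((((((θ.rebindX F 2 X').toStage5₁₃CoPHChi F 2 (chiβOfRecord₁₃Ax F 2 θ.toStage13Params)).pinB10 F 2).pinY F 2 Y₀).pinZ F 2 (Z11OfRecord F 2 ζ)).pinW F 2 W₀) P)
    (h05S : ∀ P : B12.RunParams,
      (upOfRecord₅CS F 2 ((((((θ.rebindX F 2 X').toStage5₁₃CoPHChi F 2 (chiβOfRecord₁₃Ax F 2 θ.toStage13Params)).pinB10 F 2).pinY F 2 Y₀).pinZ F 2 (Z11OfRecord F 2 ζ)).pinW F 2 W₀) P).b8)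
    (h06 : B9LeafX Y₀)
    (h07 : B11Leaf (Z11OfRecord F 2 ζ))
    (h08 : PrintedUV3V 2 θ.L)
    (h09 : ∀ P : B12.RunParams, B12Sec2to5.Lemma4Printed (X' P).F12 (X' P).c12)
    (h09T : ∀ P : B12.RunParams, (leavesP { w with C := (datumOfRecord₁₃SepCoPHAx F 2 θ h).C } P).smallCouplings →
      (leavesP { w with C := (datumOfRecord₁₃SepCoPHAx F 2 θ h).C } P).smallFieldInductive)
    (h10 : ∀ P : B12.RunParams, B9LeafX Y₀ →
      (B10.Thm1PrintedCompact (((((((θ.rebindX F 2 X').toStage5₁₃CoPHChi F 2 (chiβOfRecord₁₃Ax F 2 θ.toStage13Params)).pinB10 F 2).pinY F 2 Y₀).pinZ F 2 (Z11OfRecord F 2 ζ)).pinW F 2 W₀).res.X P).runs10 ∧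
          B10.Thm2Printed (((((((θ.rebindX F 2 X').toStage5₁₃CoPHChi F 2 (chiβOfRecord₁₃Ax F 2 θ.toStage13Params)).pinB10 F 2).pinY F 2 Y₀).pinZ F 2 (Z11OfRecord F 2 ζ)).pinW F 2 W₀).res.X P).runs10) →
        B11Leaf (Z11OfRecord F 2 ζ) → B12Sec2to5.Lemma4Printed (X' P).F12 (X' P).c12 →
          B13.Lemma1Printed (X' P).S13 (X' P).c13 ∧ B13.Lemma2Printed (X' P).S13 (X' P).c13 ∧ B13.Lemma3Printed (X' P).S13 (X' P).c13)
    (h11 : ∀ P : B12.RunParams, (leavesP { w with C := (datumOfRecord₁₃SepCoPHAx F 2 θ h).C } P).b7 → (leavesP { w with C := (datumOfRecord₁₃SepCoPHAx F 2 θ h).C } P).b8 →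
      (leavesP { w with C := (datumOfRecord₁₃SepCoPHAx F 2 θ h).C } P).b9 → (leavesP { w with C := (datumOfRecord₁₃SepCoPHAx F 2 θ h).C } P).b10 →
      (leavesP { w with C := (datumOfRecord₁₃SepCoPHAx F 2 θ h).C } P).b11 → (leavesP { w with C := (datumOfRecord₁₃SepCoPHAx F 2 θ h).C } P).smallCouplings →
      (leavesP { w with C := (datumOfRecord₁₃SepCoPHAx F 2 θ h).C } P).smallFieldInductive → (leavesP { w with C := (datumOfRecord₁₃SepCoPHAx F 2 θ h).C } P).flowControl →
        ∀ k, k < P.K → SLaw₁₃CoPHChi F 2 θ (chiβOfRecord₁₃Ax F 2 θ.toStage13Params) P k → TLaw₁₃CoPHChi F 2 θ (chiβOfRecord₁₃Ax F 2 θ.toStage13Params) P k)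
    (hR : ∀ (P : B12.RunParams) (k : ℕ), k < P.K → TLaw₁₃CoPHChi F 2 θ (chiβOfRecord₁₃Ax F 2 θ.toStage13Params) P k → SLaw₁₃CoPHChi F 2 θ (chiβOfRecord₁₃Ax F 2 θ.toStage13Params) P (k + 1))
    (hK : ∀ P : B12.RunParams, 1 ≤ P.K → lamW.kSel P < P.K)
    (hW : ∀ P : B12.RunParams, lamW.kSel P < P.K → W₀ P = WOfRecord₁₃Ax F 2 θ.toStage13Params lamW P)
    (hW0 : ∀ P : B12.RunParams, ¬ lamW.kSel P < P.K → B15Leaf (W₀ P))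
    (h12 : ∀ P : B12.RunParams, lamW.kSel P < P.K → Step.InInterval w.γ P.K (gOfRecord₁₃Ax F 2 θ.toStage13Params P) → B15Leaf (WOfRecord₁₃Ax F 2 θ.toStage13Params lamW P))
    {γ₁₃ : ℝ} (hγ₁₃ : w.γ ≤ γ₁₃) (hcor : B16.Cor3With (datumOfRecord₁₃SepCoPHVAx F 2 θ h v).C γ₁₃ w.em w.ep) :
    NodesAtSomeRecord13PWSVW F :=
  ⟨θ, h, v, w, N24_rung1VW_bodyAt_pointed θ h hθ hU v X' Y₀ ζ W₀ lamW w hC hγ hL hup h05S h06 h07 h08 h09 h09T h10 h11 hR hK hW hW0 h12 hγ₁₃ hcor⟩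

end Rung

/-! ## §4. ★★★★ THE REGISTERED STUB's SIGNATURE `∀ F, Inhabited13 F → NodesAtSomeRecord13PWSVW F` FROM THE PER-NODE BILLS, each read AT THE RUNG's BOUND θ -/

/-- **★★★★ RUNG 1ⱽᵂ's BODY AT THE RUNG's BOUND θ FROM THE PER-NODE BILLS AT θ** — for ONE `F`, ONE rung-0 witness `θ` (re-centred provisos `h`, unity ∧ slots, admissible — K0ᴬ's body) and a
prescribed ceiling letter `βup`, the children's products AT θ (N05 `h05` … N13 `h13`, shapes as in `stub1TextVW_of_bills_atWitnessFamily` below, at one θ) yield a revision `v` and a world `w` with `w.βup = βup`,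
`0 < w.γ` and RUNG 1ⱽᵂ's BODY at `(θ, h, v, w)`: the world S-bound to the χ⋆-four-pin chain of the H-X-pinned parameter (`XPinned₁₃H θ λ₈ λ₁₂ λ₁₃`, [B9] bundle `Y₀`, `Z11OfRecord ζ`, `W₀ :=` the
bundle of record on the pinned runs and a true [IV] leaf elsewhere), window `γ := min θ.γ (min γ₉ (min γ₁₁ (min γ₁₂ γ₁₃)))`, N13's dependence functions, `β₀ := 1`.  The POINTED form the LINE's later
rungs consume (stub 2ⱽᵂ re-reads it with `βup := B + r`).  CONDITIONAL; closes nothing; nothing of Bałaban asserted.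
[cite: Balaban1989LargeFieldII, Thm 1 p.355, (0.1) pp.355–356, p.387, p.391; Balaban1985RegularSpaces, Thm 2 p.83, Thm 8 (1.146) p.101; Balaban1985BackgroundPropagators, Thm 3.1 p.397; Balaban1985Variational, Thm 1 p.279; Balaban1985UV3, Thm 1 p.257, Thm 2 p.272; Balaban1987RG1, Lemma 4 p.280, Thm 1 p.259, (2.9) p.266; Balaban1988RG2Cluster, Lemmas 1–3 pp.9–20; Balaban1988Convergent, Thm 2 p.263, (2.18) p.257, Cor. 3 (2.50) p.264; Balaban1989LargeFieldI, (0.2)–(0.6) p.176, Prop. 1 p.194 (bookkeeping over the cell's DAG)] -/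
theorem N24_rung1VW_bodyAt_of_bills_at (F : T4Family) (θ : Stage13HParams F 2) (h : θ.Provisos₁₃SepCoPHAx F 2) (hU : θ.ZhUnity F 2 ∧ θ.SlotsNondegenerate₁₃Ax F 2) (hθ : θ.Admissible F 2)
    (h05 : ∃ lam8 : ResidB8 θ.toStage3Params, B8LeafOfRecordSubBH θ.toStage3Params lam8)
    (h06 : ∃ Y₀ : PrintedCarriers9X, B9LeafX Y₀)
    (h07 : ∃ ζ : ResidZ F 2, B11Leaf (Z11OfRecord F 2 ζ))
    (h08 : PrintedUV3V 2 θ.L)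
    (h09 : ∃ lam12 : ResidB12 F 2 θ.τ9.M, ∀ P : B12.RunParams, B12Sec2to5.Lemma4Printed (F12OfRecord₁₂ F 2 θ.toStage12Params lam12 P) (lam12 P).consts)
    (h09T : ∃ γ₉ : ℝ, 0 < γ₉ ∧ ∀ w : WorldP, w.C = (datumOfRecord₁₃SepCoPHAx F 2 θ h).C → w.γ ≤ γ₉ →
        ∀ P : B12.RunParams, (leavesP w P).smallCouplings → (leavesP w P).smallFieldInductive)
    (h10 : ∃ lam13 : B12.RunParams → ResidB13 θ.toStage3Params, ∀ P : B12.RunParams, B13LeafOfRecord θ.toStage3Params (lam13 P))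
    (h11 : ∀ βup β₀ : ℝ, ∃ γ₁₁ : ℝ, 0 < γ₁₁ ∧ ∀ w : WorldP, w.C = (datumOfRecord₁₃SepCoPHAx F 2 θ h).C → w.βup = βup → w.β₀ = β₀ → w.γ ≤ γ₁₁ →
        ∀ P : B12.RunParams, (leavesP w P).b7 → (leavesP w P).b8 → (leavesP w P).b9 → (leavesP w P).b10 → (leavesP w P).b11 →
          (leavesP w P).smallCouplings → (leavesP w P).smallFieldInductive → (leavesP w P).flowControl →
            ∀ k, k < P.K → SLaw₁₃CoPHChi F 2 θ (chiβOfRecord₁₃Ax F 2 θ.toStage13Params) P k → TLaw₁₃CoPHChi F 2 θ (chiβOfRecord₁₃Ax F 2 θ.toStage13Params) P k)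
    (hR : ∀ (P : B12.RunParams) (k : ℕ), k < P.K → TLaw₁₃CoPHChi F 2 θ (chiβOfRecord₁₃Ax F 2 θ.toStage13Params) P k → SLaw₁₃CoPHChi F 2 θ (chiβOfRecord₁₃Ax F 2 θ.toStage13Params) P (k + 1))
    (h12 : ∃ (lamW : ResidW F 2) (γ₁₂ : ℝ), 0 < γ₁₂ ∧ (∀ P : B12.RunParams, 1 ≤ P.K → lamW.kSel P < P.K) ∧
        ∀ P : B12.RunParams, lamW.kSel P < P.K → Step.InInterval γ₁₂ P.K (gOfRecord₁₃Ax F 2 θ.toStage13Params P) → B15Leaf (WOfRecord₁₃Ax F 2 θ.toStage13Params lamW P))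
    (h13 : ∃ (v : Revision₁₃Ax F 2 θ h) (γ₁₃ : ℝ), 0 < γ₁₃ ∧ ∃ em ep : ℝ → ℝ, B16.Cor3With (datumOfRecord₁₃SepCoPHVAx F 2 θ h v).C γ₁₃ em ep)
    (βup : ℝ) :
    ∃ (v : Revision₁₃Ax F 2 θ h) (w : WorldP), w.βup = βup ∧ 0 < w.γ ∧
      ((θ.ZhUnity F 2 ∧ θ.SlotsNondegenerate₁₃Ax F 2) ∧ θ.Admissible F 2 ∧ RecordSV F θ h v w ∧
        (∀ P : B12.RunParams, (leavesP w P).smallCouplings → Nodes (leavesP w P)) ∧ PrintedUV3V 2 θ.L ∧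
        ∃ lam : ResidW F 2, (∀ P : B12.RunParams, 1 ≤ P.K → lam.kSel P < P.K) ∧
          ∀ P : B12.RunParams, lam.kSel P < P.K → (leavesP w P).smallCouplings → ((leavesP w P).rBasicStep ↔ B15Leaf (WOfRecord₁₃Ax F 2 θ.toStage13Params lam P))) := by
  obtain ⟨lam8, h05⟩ := h05
  obtain ⟨Y₀, h06⟩ := h06
  obtain ⟨ζ, h07⟩ := h07
  obtain ⟨lam12, h09⟩ := h09
  obtain ⟨γ₉, hγ₉, h09T⟩ := h09T
  obtain ⟨lam13, h10⟩ := h10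
  obtain ⟨γ₁₁, hγ₁₁, h11⟩ := h11 βup 1
  obtain ⟨lamW, γ₁₂, hγ₁₂, hK, h12⟩ := h12
  obtain ⟨v, γ₁₃, hγ₁₃, em, ep, hcor⟩ := h13
  have hγ₀ : 0 < θ.γ := hθ.toStage9.gamma_pos
  have hL1 : (1 : ℝ) < (θ.toStage13Params.L : ℝ) := by exact_mod_cast θ.toStage13Params.hL.2
  set γw : ℝ := min θ.γ (min γ₉ (min γ₁₁ (min γ₁₂ γ₁₃))) with hγw_def
  have hγw0 : 0 < γw := lt_min hγ₀ (lt_min hγ₉ (lt_min hγ₁₁ (lt_min hγ₁₂ hγ₁₃)))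
  have hγwγ : γw ≤ θ.γ := min_le_left _ _
  have hγw9 : γw ≤ γ₉ := (min_le_right _ _).trans (min_le_left _ _)
  have hγw11 : γw ≤ γ₁₁ := (min_le_right _ _).trans ((min_le_right _ _).trans (min_le_left _ _))
  have hγw12 : γw ≤ γ₁₂ := (min_le_right _ _).trans ((min_le_right _ _).trans ((min_le_right _ _).trans (min_le_left _ _)))
  have hγw13 : γw ≤ γ₁₃ := (min_le_right _ _).trans ((min_le_right _ _).trans ((min_le_right _ _).trans (min_le_right _ _)))
  -- the carriers: the H-X-pin of the three groups of record, the [B9] bundle, the Z-layer, the W-bundle of record on the pinned runs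
  let X' : B12.RunParams → PrintedCarriersR := XPinned₁₃H F 2 θ.toStage13Params lam8 lam12 lam13
  let W₀ : B12.RunParams → PrintedCarriers15 := fun P =>
    if lamW.kSel P < P.K then WOfRecord₁₃Ax F 2 θ.toStage13Params lamW P else (exists_printedCarriers15_b15Leaf (F.P P.K)).choose
  have hW : ∀ P : B12.RunParams, lamW.kSel P < P.K → W₀ P = WOfRecord₁₃Ax F 2 θ.toStage13Params lamW P := fun P hk => if_pos hk
  have hW0 : ∀ P : B12.RunParams, ¬ lamW.kSel P < P.K → B15Leaf (W₀ P) := fun P hk => by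
    show B15Leaf (if lamW.kSel P < P.K then WOfRecord₁₃Ax F 2 θ.toStage13Params lamW P else (exists_printedCarriers15_b15Leaf (F.P P.K)).choose)
    rw [if_neg hk]
    exact (exists_printedCarriers15_b15Leaf (F.P P.K)).choose_spec
  -- the world: S-bound to the χ⋆-four-pin chain, bound to the REVISED re-centred datum, N13's dependence functions, the shrunk window
  let w : WorldP :=
    { C := (datumOfRecord₁₃SepCoPHVAx F 2 θ h v).C
      γ := γw, em := em, ep := ep, βup := βup, β₀ := 1, β₀_pos := one_pos, b := 1, b_pos := one_pos
      L := (θ.toStage13Params.L : ℝ), one_lt_L := hL1, gR := 0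
      up := fun P => upOfRecord₅CS F 2 ((((((θ.rebindX F 2 X').toStage5₁₃CoPHChi F 2 (chiβOfRecord₁₃Ax F 2 θ.toStage13Params)).pinB10 F 2).pinY F 2 Y₀).pinZ F 2 (Z11OfRecord F 2 ζ)).pinW F 2 W₀) P }
  have hC : w.C = (datumOfRecord₁₃SepCoPHVAx F 2 θ h v).C := rfl
  have hC₀ : ({ w with C := (datumOfRecord₁₃SepCoPHAx F 2 θ h).C } : WorldP).C = (datumOfRecord₁₃SepCoPHAx F 2 θ h).C := rfl
  refine ⟨v, w, rfl, hγw0, N24_rung1VW_bodyAt_pointed θ h hθ hU v X' Y₀ ζ W₀ lamW w hC ⟨hγw0, hγwγ⟩ rfl (fun _ => rfl)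
    (fun P => (socket05S_chain_pinX3H_iff_Ax θ lam8 lam12 lam13 Y₀ ζ W₀ P).2 h05) h06 h07 h08
    (fun P => (socket09_XPinned₁₃H_iff θ lam8 lam12 lam13 P).2 (h09 P)) (h09T _ hC₀ hγw9)
    (fun P _ _ _ _ => (socket10_XPinned₁₃H_iff θ lam8 lam12 lam13 P).2 (h10 P)) (h11 _ hC₀ rfl rfl hγw11) hR hK hW hW0
    (fun P hk hI => h12 P hk fun k hkk => ⟨(hI k hkk).1, (hI k hkk).2.trans hγw12⟩) hγw13 hcor⟩

/-- **★★★★ `stub_nodes13PWSVW`'s TEXT FROM THE PER-NODE BILLS AT A WITNESS FAMILY** (the engine's §3 shape, ✓p810415: a family `Θ F i` of rung-0 tuples — re-centred provisos `hP`, unity ∧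
slots `hU`, admissible `hθ` — inhabited whenever rung 0 holds at `F` (`hK0`); every bill is read AT THE FAMILY's MEMBERS, i.e. at the θ the rung will bind — dag-lead g41 GATE v1.273 (c)).
The children hand back, at each `Θ F i`: N05 a residual [B8] layer carrying the REPAIRED SURVIVING SLOT `B8LeafOfRecordSubBH θ₃ λ₈` (`h05`); N06 a [B9] bundle with its leaf (`h06`); N07 a
residual Z-layer with the [B11] leaf at `Z11OfRecord ζ` (`h07`); N08 print's [B10] sentence `PrintedUV3V 2 θ.L` (`h08`); N09 a [B12] frame of record with Lemma 4 (`h09`) and the Theorem-3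
member at every world on the re-centred datum below a radius (`h09T`); N10 a [B13] group of record with its leaf (`h10`); N11 (S1ᵀ) at every world on the re-centred datum with given
`βup ∕ β₀` below a radius (`h11`); N13's (R₁₃) laws `hR`; N12 a residual W-layer pinned at a genuine step (`kSel P < P.K` once `1 ≤ P.K`) with [IV]'s basic step at the RE-CENTRED BUNDLE OF
RECORD `WOfRecord₁₃Ax θ λ P` on the runs inside a coupling window (`h12`; dag-n12-d's currency — PAYABLE ONLY AT MEMBERS WHOSE `p–p′` SELECTOR IS THE LIVE ONE, dag-n12-d I.22983: every N12
road concludes at `θ.toStage13Params.liveRepin₁₃Ax`; the K1ᴬ face's witness `theta13OfThm1CCMWZBAx …` IS on the re-pin, `rfl`); N13 an a.e.-REVISION `v` of the re-centred record with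
[III] Cor. 3 «with e±» at the revised datum below a radius (`h13`) ⟹ the registered stub's SIGNATURE `∀ F, Inhabited13 F → NodesAtSomeRecord13PWSVW F`, the rung binding `θ := Θ F i` and
the revision ∕ world of `N24_rung1VW_bodyAt_of_bills_at` (`βup` free, `β₀ := 1`).  WHICH CHILD BLOCKS `stub_nodes13PWSVW` = this hypothesis list, BY NAME, at the family.  CONDITIONAL
(audit `proof.conditional` displays the bills); closes nothing; nothing of Bałaban asserted.
[cite: Balaban1989LargeFieldII, Thm 1 p.355, (0.1) pp.355–356, p.387, p.391; Balaban1985RegularSpaces, Thm 2 p.83, Thm 8 (1.146) p.101; Balaban1985BackgroundPropagators, Thm 3.1 p.397; Balaban1985Variational, Thm 1 p.279; Balaban1985UV3, Thm 1 p.257, Thm 2 p.272; Balaban1987RG1, Lemma 4 p.280, Thm 1 p.259, Thm 3 p.264, (2.9) p.266; Balaban1988RG2Cluster, Lemmas 1–3 pp.9–20; Balaban1988Convergent, Thm 2 p.263, (2.18) p.257, (3.22) p.269, Cor. 3 (2.50) p.264; Balaban1989LargeFieldI, (0.2)–(0.6) p.176, Prop. 1 p.194 (bookkeeping over the cell's DAG)]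 -/
theorem stub1TextVW_of_bills_atWitnessFamily (ι : T4Family → Type) (Θ : ∀ F : T4Family, ι F → Stage13HParams F 2) (hK0 : ∀ F : T4Family, Inhabited13 F → Nonempty (ι F))
    (hP : ∀ (F : T4Family) (i : ι F), (Θ F i).Provisos₁₃SepCoPHAx F 2) (hU : ∀ (F : T4Family) (i : ι F), (Θ F i).ZhUnity F 2 ∧ (Θ F i).SlotsNondegenerate₁₃Ax F 2)
    (hθ : ∀ (F : T4Family) (i : ι F), (Θ F i).Admissible F 2)
    (h05 : ∀ (F : T4Family) (i : ι F), ∃ lam8 : ResidB8 (Θ F i).toStage3Params, B8LeafOfRecordSubBH (Θ F i).toStage3Params lam8)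
    (h06 : ∀ (F : T4Family) (_ : ι F), ∃ Y₀ : PrintedCarriers9X, B9LeafX Y₀)
    (h07 : ∀ (F : T4Family) (_ : ι F), ∃ ζ : ResidZ F 2, B11Leaf (Z11OfRecord F 2 ζ))
    (h08 : ∀ (F : T4Family) (i : ι F), PrintedUV3V 2 (Θ F i).L)
    (h09 : ∀ (F : T4Family) (i : ι F), ∃ lam12 : ResidB12 F 2 (Θ F i).τ9.M,
      ∀ P : B12.RunParams, B12Sec2to5.Lemma4Printed (F12OfRecord₁₂ F 2 (Θ F i).toStage12Params lam12 P) (lam12 P).consts)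
    (h09T : ∀ (F : T4Family) (i : ι F), ∃ γ₉ : ℝ, 0 < γ₉ ∧ ∀ w : WorldP, w.C = (datumOfRecord₁₃SepCoPHAx F 2 (Θ F i) (hP F i)).C → w.γ ≤ γ₉ →
      ∀ P : B12.RunParams, (leavesP w P).smallCouplings → (leavesP w P).smallFieldInductive)
    (h10 : ∀ (F : T4Family) (i : ι F), ∃ lam13 : B12.RunParams → ResidB13 (Θ F i).toStage3Params, ∀ P : B12.RunParams, B13LeafOfRecord (Θ F i).toStage3Params (lam13 P))
    (h11 : ∀ (F : T4Family) (i : ι F), ∀ βup β₀ : ℝ, ∃ γ₁₁ : ℝ, 0 < γ₁₁ ∧ ∀ w : WorldP, w.C = (datumOfRecord₁₃SepCoPHAx F 2 (Θ F i) (hP F i)).C → w.βup = βup → w.β₀ = β₀ → w.γ ≤ γ₁₁ →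
      ∀ P : B12.RunParams, (leavesP w P).b7 → (leavesP w P).b8 → (leavesP w P).b9 → (leavesP w P).b10 → (leavesP w P).b11 →
        (leavesP w P).smallCouplings → (leavesP w P).smallFieldInductive → (leavesP w P).flowControl →
          ∀ k, k < P.K → SLaw₁₃CoPHChi F 2 (Θ F i) (chiβOfRecord₁₃Ax F 2 (Θ F i).toStage13Params) P k → TLaw₁₃CoPHChi F 2 (Θ F i) (chiβOfRecord₁₃Ax F 2 (Θ F i).toStage13Params) P k)
    (hR : ∀ (F : T4Family) (i : ι F) (P : B12.RunParams) (k : ℕ), k < P.K →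
      TLaw₁₃CoPHChi F 2 (Θ F i) (chiβOfRecord₁₃Ax F 2 (Θ F i).toStage13Params) P k → SLaw₁₃CoPHChi F 2 (Θ F i) (chiβOfRecord₁₃Ax F 2 (Θ F i).toStage13Params) P (k + 1))
    (h12 : ∀ (F : T4Family) (i : ι F), ∃ (lamW : ResidW F 2) (γ₁₂ : ℝ), 0 < γ₁₂ ∧ (∀ P : B12.RunParams, 1 ≤ P.K → lamW.kSel P < P.K) ∧
      ∀ P : B12.RunParams, lamW.kSel P < P.K → Step.InInterval γ₁₂ P.K (gOfRecord₁₃Ax F 2 (Θ F i).toStage13Params P) → B15Leaf (WOfRecord₁₃Ax F 2 (Θ F i).toStage13Params lamW P))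
    (h13 : ∀ (F : T4Family) (i : ι F), ∃ (v : Revision₁₃Ax F 2 (Θ F i) (hP F i)) (γ₁₃ : ℝ), 0 < γ₁₃ ∧ ∃ em ep : ℝ → ℝ,
      B16.Cor3With (datumOfRecord₁₃SepCoPHVAx F 2 (Θ F i) (hP F i) v).C γ₁₃ em ep)
    (βup : ℝ) :
    ∀ F : T4Family, Inhabited13 F → NodesAtSomeRecord13PWSVW F := by
  intro F hF
  obtain ⟨i⟩ := hK0 F hF
  obtain ⟨v, w, -, -, hbody⟩ := N24_rung1VW_bodyAt_of_bills_at F (Θ F i) (hP F i) (hU F i) (hθ F i) (h05 F i) (h06 F i) (h07 F i) (h08 F i) (h09 F i)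
    (h09T F i) (h10 F i) (h11 F i) (hR F i) (h12 F i) (h13 F i) βup
  exact ⟨Θ F i, hP F i, v, w, hbody⟩

end Summit.QuantumFields.YangMills.BalabanUVNodes.N24Stub1VWShareK1AxV11

end
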